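import Summits.QuantumFields.GaugeBoot.ClassBDiagonalWordBlocks
import HarnessLib

/-!
# The `R_site` blocks of a Class-B state, indexed by half-WORDS between mirror sites, with
loop-variable entries, are positive semidefinite (gauge-boot, task L3(α), companion of 4/4)

HONEST FRAMING (cell `pub-gaugeboot`, page 1 of every file): the venture produces certified bounds
on lattice expectations at stated coupling, gauge group, dimension and torus size; NOT a mass gap,
NOT a continuum limit, NOT a string tension; NOT Yang–Mills-summit-bearing (barriers
`FixedCouplingUltralocality`, `PerturbativeInvisibility`). Structural bookkeeping for the Class-B
column (SCOPING A18); certifies no number.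

## Content

`ClassBDiagonalWordBlocks.lean` did the DIAGONAL family. The SITE family (mirror `x_i = 0`, which
also passes through lattice sites) is the same bookkeeping with the axis reflection
`configSiteReflect i` (links in direction `i` reversed, `x_i ↦ -x_i`; word image `Step.flipAt i`,
tree `wordHolonomyZd_configSiteReflect`) and the closed half `siteHalfEdges i = {x_i ≥ 0}`:

* `zdSiteReflect_of_apply_eq_zero`, `Word.endpointZd_map_flipAt`, `wordHolonomyZd_siteGlue` — the
  glued loop `O_b ++ (flip_i O_a)⁻¹` at a mirror site `p` (`p_i = 0`, `O_a, O_b : p → q`, `q_i = 0`)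
  has holonomy `hol_p(O_b)(U) · (hol_p(O_a)(Θ_i U))⁻¹`;
* **`sum_conj_mul_integral_trace_siteGlue_nonneg`** — for a finite measure on `LGConfig d G`
  reflection positive for `configSiteReflect i` / `siteHalfEdges i`, half-words with holonomies
  supported in `siteHalfEdges i`, every continuous `τ` and `c ∈ ℂ^n`:
  `0 ≤ Σ_{ab} c̄_a c_b ∫ tr τ(hol_p(O_b ++ (flip_i O_a)⁻¹)) dμ`;
* **`ClassBState.rSiteWordBlock_nonneg`** — the Class-B `R_site` block in the certificate
  normalisation `wordLoopZd ρ = (1/N) Re tr ρ`, real coefficients.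

The measurability of `configSiteReflect i` is taken as a hypothesis (it holds for Borel `G`, tree
`measurable_configSiteReflect` under second countability), as in `ClassBState.rpBlock_nonneg`.

## What is NOT claimed

The LINK family (mirror `x_i = ½` contains no sites; its blocks need the crossing link under the
feet of the words and the Gibbs property — torus version `WordLinkRP` of lean1; not here);
inhabitation of Class B; anything numerical. [folklore] mechanism (Osterwalder–Seiler 1978 §2).
-/

open MeasureTheory Complex Finset Function
open scoped ComplexOrder

namespace Summit.QuantumFields.GaugeBoot

open Literature.MathematicalPhysics.QuantumFieldTheory
open Literature.MathematicalPhysics.QuantumLattice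
open Literature.RepresentationTheory.CompactGroups

noncomputable section

/-! ## Geometry of the site mirror on words -/

section Geometry

variable {d : ℕ}

/-- A mirror site (`x_i = 0`) is fixed by the axis reflection. -/
theorem zdSiteReflect_of_apply_eq_zero (i : Fin d) {x : Fin d → ℤ} (hx : x i = 0) :
    zdSiteReflect i x = x := by
  rw [zdSiteReflect, hx, neg_zero, ← hx, Function.update_eq_self]

/-- Endpoints of reflected words: `end_{θ_i x}(flip_i w) = θ_i (end_x w)`. -/
theorem Word.endpointZd_map_flipAt (i : Fin d) :
    ∀ (x : Fin d → ℤ) (w : Word d),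
      Word.endpointZd (zdSiteReflect i x) (w.map (Step.flipAt i)) =
        zdSiteReflect i (Word.endpointZd x w)
  | x, [] => rfl
  | x, s :: w => by
    rw [List.map_cons, Word.endpointZd_cons, Word.endpointZd_cons, ← zdSiteReflect_applyZd,
      Word.endpointZd_map_flipAt i (s.applyZd x) w]

variable {G : Type*} [Group G]

/-- The holonomy of the glued loop `O_b ++ (flip_i O_a)⁻¹` at the mirror site `p` (`p_i = 0`;
`O_a, O_b : p → q` with `q_i = 0`) is `hol_p(O_b)(U) · (hol_p(O_a)(Θ_i U))⁻¹`. -/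
theorem wordHolonomyZd_siteGlue {i : Fin d} {p q : Fin d → ℤ} (hp : p i = 0) (hq : q i = 0)
    (U : LGConfig d G) {Oa Ob : Word d} (ha : Word.endpointZd p Oa = q)
    (hb : Word.endpointZd p Ob = q) :
    wordHolonomyZd U p (Ob ++ Word.reverse (Oa.map (Step.flipAt i))) =
      wordHolonomyZd U p Ob * (wordHolonomyZd (configSiteReflect i U) p Oa)⁻¹ := by
  have hend : Word.endpointZd p (Oa.map (Step.flipAt i)) = q := by
    have h := Word.endpointZd_map_flipAt i p Oa
    rw [zdSiteReflect_of_apply_eq_zero i hp, ha, zdSiteReflect_of_apply_eq_zero i hq] at h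
    exact h
  rw [wordHolonomyZd_append, hb, ← hend, wordHolonomyZd_reverse, wordHolonomyZd_configSiteReflect,
    zdSiteReflect_of_apply_eq_zero i hp]

end Geometry

/-! ## Site-RP states on `ℤ^d`: blocks indexed by half-words -/

section Zd

variable {d N M : ℕ} {G : Type*} [Group G] [TopologicalSpace G] [IsTopologicalGroup G]
  [CompactSpace G] [MeasurableSpace G] [BorelSpace G] (ρ : G →* Matrix (Fin N) (Fin N) ℂ)
  (τ : G →* Matrix (Fin M) (Fin M) ℂ)

/-- ★★★ **The `R_site` block of an axis-reflection-positive state, indexed by half-WORDS, is PSD —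
glued-loop trace entries, every representation.** `μ` a finite measure on `LGConfig d G`,
reflection positive for `configSiteReflect i` on the closed half `siteHalfEdges i`
(`Θ_i` measurable); mirror sites `p, q` (`p_i = q_i = 0`); words `O_a : p → q` whose holonomies
depend only on `siteHalfEdges i`; `τ` continuous; `c ∈ ℂ^n`:
`0 ≤ Σ_{ab} c̄_a c_b ∫ tr τ(hol_p(O_b ++ (flip_i O_a)⁻¹)) dμ`. -/
theorem sum_conj_mul_integral_trace_siteGlue_nonneg (hτ : Continuous τ)
    {μ : Measure (LGConfig d G)} [IsFiniteMeasure μ] {i : Fin d}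
    (hΘ : Measurable (configSiteReflect (G := G) i : LGConfig d G → LGConfig d G))
    (hRP : IsReflectionPositiveFor (configSiteReflect i) (siteHalfEdges i) μ)
    {p q : Fin d → ℤ} (hp : p i = 0) (hq : q i = 0) {n : ℕ} (O : Fin n → Word d)
    (hend : ∀ a, Word.endpointZd p (O a) = q)
    (hhalf : ∀ a, DependsOn (fun U : LGConfig d G => wordHolonomyZd U p (O a)) (siteHalfEdges i))
    (c : Fin n → ℂ) :
    0 ≤ ∑ a, ∑ b, (starRingEnd ℂ) (c a) * c b *
      ∫ U, (τ (wordHolonomyZd U p (O b ++ Word.reverse ((O a).map (Step.flipAt i))))).trace ∂μ := by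
  have hσc : Continuous (CompactGroup.unitarize τ hτ) := CompactGroup.continuous_unitarize τ hτ
  simp_rw [wordHolonomyZd_siteGlue hp hq _ (hend _) (hend _)]
  refine sum_conj_mul_integral_trace_mul_inv_nonneg_of_rp τ hτ (Θ := configSiteReflect i)
    (C := fun a U => wordHolonomyZd U p (O a))
    (D := fun a U => wordHolonomyZd (configSiteReflect i U) p (O a))
    (fun a => entryMeasurable_wordHolonomyZd _ hσc (O a) p) (fun a => ?_) (fun a U => rfl)
    (fun m k c' => ?_) c
  · have hDa : (fun U : LGConfig d G => wordHolonomyZd (configSiteReflect i U) p (O a)) =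
        fun U => wordHolonomyZd U (zdSiteReflect i p) ((O a).map (Step.flipAt i)) :=
      funext fun U => wordHolonomyZd_configSiteReflect i U p (O a)
    rw [hDa]
    exact entryMeasurable_wordHolonomyZd _ hσc _ _
  · exact hRP.sum_mul_conj_nonneg hΘ
      (fun a U => CompactGroup.unitarize τ hτ (wordHolonomyZd U p (O a)) m k)
      (fun a => entryMeasurable_wordHolonomyZd _ hσc (O a) p m k)
      (fun a => ⟨1, fun U => CompactGroup.norm_unitarize_apply_le_one τ hτ _ m k⟩)
      (fun a => fun U V hUV => by
        have h : wordHolonomyZd U p (O a) = wordHolonomyZd V p (O a) := hhalf a hUV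
        simp only [h]) c'

/-- ★★★ **Class-B `R_site` blocks with loop-variable entries.** For a Class-B state `ω`,
continuous `ρ`, an axis `i` (`Θ_i` measurable), mirror sites `p, q` (`p_i = q_i = 0`), half-words
`O_a : p → q` (holonomies supported in `{x_i ≥ 0}`) and REAL coefficients:
`0 ≤ Σ_{ab} c_a c_b ∫ W_p(O_b ++ (flip_i O_a)⁻¹) dω.μ` (`W = wordLoopZd ρ = (1/N) Re tr ρ`). -/
theorem ClassBState.rSiteWordBlock_nonneg {β : ℝ} (ω : ClassBState d ρ β) (hρ : Continuous ρ)
    {i : Fin d} (hΘ : Measurable (configSiteReflect (G := G) i : LGConfig d G → LGConfig d G))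
    {p q : Fin d → ℤ} (hp : p i = 0) (hq : q i = 0) {n : ℕ}
    (O : Fin n → Word d) (hend : ∀ a, Word.endpointZd p (O a) = q)
    (hhalf : ∀ a, DependsOn (fun U : LGConfig d G => wordHolonomyZd U p (O a)) (siteHalfEdges i))
    (c : Fin n → ℝ) :
    0 ≤ ∑ a, ∑ b, c a * c b * ∫ U, wordLoopZd ρ p
      (O b ++ Word.reverse ((O a).map (Step.flipAt i))) U ∂ω.μ := by
  haveI := ω.isProbabilityMeasure
  have h := sum_conj_mul_integral_trace_siteGlue_nonneg ρ hρ hΘ (ω.siteRP i) hp hq O hend hhalf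
    (fun a => (c a : ℂ))
  set w : Fin n → Fin n → Word d :=
    fun a b => O b ++ Word.reverse ((O a).map (Step.flipAt i)) with hw
  have hE : ∀ a b, WilsonRP.EntryMeasurable ρ (fun U : LGConfig d G => wordHolonomyZd U p (w a b)) :=
    fun a b => entryMeasurable_wordHolonomyZd ρ hρ (w a b) p
  have htm : ∀ a b, Measurable fun U : LGConfig d G => (ρ (wordHolonomyZd U p (w a b))).trace :=
    fun a b => by
    simp only [Matrix.trace, Matrix.diag_apply]
    exact Finset.measurable_sum _ fun k _ => hE a b k k
  have htb : ∀ (g : G), ‖(ρ g).trace‖ ≤ N := fun g => by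
    rw [← CompactGroup.trace_unitarize ρ hρ g, Matrix.trace]
    calc ‖∑ k, Matrix.diag (CompactGroup.unitarize ρ hρ g) k‖
        ≤ ∑ k, ‖Matrix.diag (CompactGroup.unitarize ρ hρ g) k‖ := norm_sum_le _ _
      _ ≤ ∑ _k : Fin N, (1 : ℝ) := Finset.sum_le_sum fun k _ => by
          rw [Matrix.diag_apply]; exact CompactGroup.norm_unitarize_apply_le_one ρ hρ g k k
      _ = N := by simp
  have hti : ∀ a b, Integrable (fun U : LGConfig d G => (ρ (wordHolonomyZd U p (w a b))).trace) ω.μ :=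
    fun a b => Integrable.of_bound (htm a b).aestronglyMeasurable (N : ℝ) (ae_of_all _ fun U => htb _)
  have hW : ∀ a b, ∫ U, wordLoopZd ρ p (w a b) U ∂ω.μ =
      (N : ℝ)⁻¹ * (∫ U, (ρ (wordHolonomyZd U p (w a b))).trace ∂ω.μ).re := fun a b => by
    simp only [wordLoopZd_apply]
    rw [integral_const_mul]
    have hre := integral_re (hti a b)
    simp only [RCLike.re_to_complex] at hre
    rw [hre]
  have key : ∑ a, ∑ b, c a * c b * ∫ U, wordLoopZd ρ p (w a b) U ∂ω.μ =
      (N : ℝ)⁻¹ * (∑ a, ∑ b, (starRingEnd ℂ) (c a : ℂ) * (c b : ℂ) *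
        ∫ U, (ρ (wordHolonomyZd U p (w a b))).trace ∂ω.μ).re := by
    rw [Complex.re_sum, Finset.mul_sum]
    refine Finset.sum_congr rfl fun a _ => ?_
    rw [Complex.re_sum, Finset.mul_sum]
    refine Finset.sum_congr rfl fun b _ => ?_
    rw [hW, Complex.conj_ofReal, mul_assoc (c a : ℂ), Complex.re_ofReal_mul, Complex.re_ofReal_mul]
    ring
  rw [key]
  exact mul_nonneg (inv_nonneg.2 (Nat.cast_nonneg N)) (Complex.nonneg_iff.1 h).1

end Zd

end

end Summit.QuantumFields.GaugeBoot
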